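import Summits.ABC.IUTFork.Cor312SettingDHVol
import Summits.ABC.IUTFork.Cor312TeamBCapstoneRealDH
import HarnessLib

/-!
# [IUTchIII] Cor. 3.12, TEAM B — the capstone AT THE CANONICAL ASSEMBLED SETTING `settingDHVol`:
# reference region = the `m = 0` Kummer image; `hR` and `hul_nonempty` DISCHARGED

Record-only file (D-0012) of the abc-iut cell (Cor. 3.12 strategy TEAM B «estimate / log-Kummer» of
HUMAN RULING D-0067 (3), seat abc-iut-c312-12 = B2, gen 2); PROOF-ONLY; TAKES NO SIDE. The
real-assembly capstone (`Cor312TeamBCapstoneRealDH`, p415747) reduces the printed `Statement` of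
Cor. 3.12, for ANY setting over `Real.situationDHVol`, to Kummer-realisation data
(`hΨ`/`hthetaEq`/`hR`) + four finiteness residuals + the gap input `GlobalVolumeTransport`. At the
CANONICAL assembled setting — abc-iut-c312-5's `Real.settingDHVol` (`Setting.ofComparison` over the
field-factor pieces, `hadm` and `hul_nonempty` PROVED) — two more obligations fall:

* `thetaRegion_settingDHVol` / `qRegion_settingDHVol` — bookkeeping (`rfl`): the `m`-th Θ-pilot region
  IS `factorMapDH⁻¹(thetaBox m (thetaPilot))`, the `q`-region IS `factorMapDH⁻¹(hullSet (qCentre))` —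
  the definitional forms the instance teams cite.
* `adm_thetaRegion_settingDHVol` — if the Θ-box at `(m, j, v_ℚ)` is a HULL-SET (`λ·𝒪_L` with nonzero
  centre — the [IUTchIII] Rmk. 3.9.5 (ii) shape `q^{j²}·𝒪` of the printed Θ-pilot regions, Prop. 3.9
  (i)(ii)), then the `m`-th Kummer image is admissible in the verbatim container (c312-5's `hadm_DH`
  read through `realizes_situationDHVol`) — NO extra hypothesis.
* `teamB_statement_of_globalVolumeTransport_settingDHVol` — **the capstone at `settingDHVol` with the
  REFERENCE REGION := the `m = 0` Kummer image** (the print's (xi-a) gluing position): `Statement`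
  follows from (1) container-preserving realisations `Ψm` (dischargeable for any norm-one-component
  multiplicative family — `Cor312KummerRealDH`, p417026), (2) `hthetaEq0`: the `m`-th Θ-image is the
  `Ψm m`-transport OF THE `m = 0` IMAGE on the container — the one residual Kummer-INSTANCE equation
  ([IUTchIII] Thm. 3.11 (ii) (a): the images "of the `m`-th transport of the Θ-pilot region";
  Prop. 3.1 (ii)), (3) `hbox0`: the `m = 0` Θ-box is a hull-set at the labels of `𝔽_l^⋇` (discharges
  `hR`), (4) the (Ind3) finiteness residuals `hθ`/`hfinθ` and `ThetaFinite`, and (5) **the gap input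
  `GlobalVolumeTransport`** (G-c312-11-1-SUPPLEMENT, kurims p. 184 l. 30–34) — `hul_nonempty` is
  PROVED (`hul_nonempty_settingDHVol`), `hV`/`hG` are theorems (p415747). NOTHING asserted about (5).

Residual list at the CANONICAL real model after this file, exactly: {`hΨ` (norm-one realisations:
machinery landed, instance = c312-3 W2-G), `hthetaEq0` (the m↦0 twist equation on the binder
`thetaBox`), `hbox0` (hull-set shape of the reference box), (Ind3) finiteness (`hθ`/`hfinθ`, owner
c312-3 `Ind3Datum`), `ThetaFinite` (c312-7 `hullDefined_of_stable`), THE GAP}. Sources read on the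
page (kurims `paper:url-4b091feeb646`): [IUTchIII] p. 92 (Prop. 3.1 (ii)), pp. 115–117 (Prop. 3.9
(i)(ii)), p. 127 (Rmk. 3.9.5 (ii)), pp. 155–156 (Thm. 3.11 (ii)), pp. 173–174 (Cor. 3.12), p. 184
((xi-a)/(xi-g)). [claim: Mochizuki2012, status: disputed] [cite: DupuyHilado2025, §4.7]
NO new definition, NO new `Prop`; no judgement on Cor. 3.12.
-/

noncomputable section

open Set Function NumberField
open Literature.IUT.LogVolume

namespace Summit.ABC

namespace IUTFork

namespace Thm311

namespace Real

open Cor312 Cor312Vol Literature.IUT.LogThetaLattice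

variable {F : Type} [Field F] [NumberField F] (X : PilotData F) {logv : PadicLogs F}
  (hlog : LogvAnalytic logv) (M : Type) [Field M] [NumberField M]
  (archPk : ∀ (j : (thetaIndex X).Label) (vQ : (thetaIndex X).VQ),
    Set ((logShellsDH X logv).Packet j vQ))
  (archSub : ∀ (j : (thetaIndex X).Label) (v : (thetaIndex X).V),
    Set ((logShellsDH X logv).Packet j ((thetaIndex X).over v)))
  (Ψ : ℤ → ∀ v : (thetaIndex X).V, v ∈ (thetaIndex X).Vbad → Set ((logShellsDH X logv).StarPacket v))
  (act : ℤ → ∀ v : (thetaIndex X).V, v ∈ (thetaIndex X).Vbad →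
    (logShellsDH X logv).StarPacket v → Module.End ℚ ((logShellsDH X logv).StarPacket v))
  (Mmod : ℤ → ∀ j : (thetaIndex X).LabelStar, Set ((logShellsDH X logv).GlobalPacket j.1))
  (region : ℤ → ∀ j : (thetaIndex X).LabelStar, FinDivisor M → ∀ vQ : (thetaIndex X).VQ,
    Set ((logShellsDH X logv).Packet j.1 vQ))
  (n : ℤ) {HT : Type} {LogLink : HT → HT → Type} {IsFull : ∀ {s t : HT}, LogLink s t → Prop}
  (lat : LGPGaussianLogThetaLattice LogLink IsFull)
  {Frd : Type} {IsoF : Frd → Frd → Type} {Ob : Frd → Type} {realify : Frd → Frd} {Strip : Type}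
  {IsoS : Strip → Strip → Type} {Mv : ∀ v : (thetaIndex X).V, v ∈ (thetaIndex X).Vbad → Type}
  [∀ v h, Monoid (Mv v h)]
  (sig : GlobalLGPFrobenioidSignature (thetaIndex X).lstar (thetaIndex X).V
    (· ∈ (thetaIndex X).Vbad) Frd IsoF Ob realify Strip IsoS Mv)
  (split : SplittingMonoids Mv) {ObΔ : Type}
  {N : ∀ v : (thetaIndex X).V, v ∈ (thetaIndex X).Vbad → Type} [∀ v h, Monoid (N v h)]
  (qData : QPilotData ObΔ N)
  (thetaBox : ℤ → Ob sig.Clgp → ∀ (j : (thetaIndex X).Label) (vQ : (thetaIndex X).VQ),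
    Set (∀ s : factorIdxDH X hlog j vQ, factorFieldDH X hlog j vQ s))
  (qCentre : ObΔ → ∀ (j : (thetaIndex X).Label) (vQ : (thetaIndex X).VQ),
    ∀ s : factorIdxDH X hlog j vQ, factorFieldDH X hlog j vQ s)
  (hq : ∀ j vQ s, qCentre (qPilotObject qData) j vQ s ≠ 0)
  (hfin : ∀ j : (thetaIndex X).Label, (Function.support fun vQ =>
    ((situationDHVol X hlog M archPk archSub Ψ act Mmod region).D n).logvol j vQ
      (factorMapDH X hlog j vQ ⁻¹'
        hullSet (factorFieldDH X hlog j vQ) (qCentre (qPilotObject qData) j vQ))).Finite)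

/-- Bookkeeping (`rfl`): the `m`-th Θ-pilot region of the canonical assembled setting IS the preimage
under the field-factor comparison of the Θ-box of the Θ-pilot object at position `m` — the
definitional form the instance teams cite. [claim: Mochizuki2012, status: disputed] -/
theorem thetaRegion_settingDHVol (m : ℤ) (j : (thetaIndex X).Label) (vQ : (thetaIndex X).VQ) :
    (settingDHVol X hlog M archPk archSub Ψ act Mmod region n lat sig split qData thetaBox qCentre
        hq hfin).thetaRegion m j vQ =
      factorMapDH X hlog j vQ ⁻¹'
        thetaBox m (settingDHVol X hlog M archPk archSub Ψ act Mmod region n lat sig split qData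
          thetaBox qCentre hq hfin).thetaPilot j vQ :=
  rfl

/-- Bookkeeping (`rfl`): the `q`-pilot region of the canonical assembled setting IS the preimage of
the hull-set `λ_q·𝒪_L` of the `q`-centre. [claim: Mochizuki2012, status: disputed] -/
theorem qRegion_settingDHVol (o : ObΔ) (j : (thetaIndex X).Label) (vQ : (thetaIndex X).VQ) :
    (settingDHVol X hlog M archPk archSub Ψ act Mmod region n lat sig split qData thetaBox qCentre
        hq hfin).qRegionOf o j vQ =
      factorMapDH X hlog j vQ ⁻¹' hullSet (factorFieldDH X hlog j vQ) (qCentre o j vQ) :=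
  rfl

/-- **Hull-set Θ-boxes give admissible Kummer images** at the canonical assembled setting: if the
Θ-box at `(m, j, v_ℚ)` is a hull-set `λ·𝒪_L` (the [IUTchIII] Rmk. 3.9.5 (ii) shape `q^{j²}·𝒪` of the
printed Θ-pilot regions, Prop. 3.9 (i)(ii)), the `m`-th Θ-pilot region is admissible in the VERBATIM
container (c312-5's `hadm_DH` through `realizes_situationDHVol`). [claim: Mochizuki2012, status:
disputed] -/
theorem adm_thetaRegion_settingDHVol {m : ℤ} {j : (thetaIndex X).Label} {vQ : (thetaIndex X).VQ}
    (hbox : IsHullSet (factorFieldDH X hlog j vQ)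
      (thetaBox m (settingDHVol X hlog M archPk archSub Ψ act Mmod region n lat sig split qData
        thetaBox qCentre hq hfin).thetaPilot j vQ)) :
    (summandPiecesDH X hlog).Adm j vQ
      ((settingDHVol X hlog M archPk archSub Ψ act Mmod region n lat sig split qData thetaBox
        qCentre hq hfin).thetaRegion m j vQ) :=
  ((realizes_situationDHVol X hlog M archPk archSub Ψ act Mmod region n).adm_iff j vQ _).1
    (hadm_DH X hlog M archPk archSub Ψ act Mmod region n j vQ _ hbox)

/-- **TEAM B CAPSTONE AT THE CANONICAL ASSEMBLED SETTING, reference = the `m = 0` Kummer image** —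
the printed `Statement` of [IUTchIII] Cor. 3.12 at `Real.settingDHVol` from: (1) container-preserving
realisations `Ψm` of the Kummer isomorphisms (norm-one multiplicative families suffice,
`Cor312KummerRealDH`); (2) `hthetaEq0` — on the container, the `m`-th Θ-Kummer image is the
`Ψm m`-transport of the `m = 0` image (the print's (xi-a) gluing position; Thm. 3.11 (ii) (a)); (3)
`hbox0` — the `m = 0` Θ-box is a hull-set at the labels of `𝔽_l^⋇` (so the reference is admissible:
`hR` DISCHARGED); (4) the (Ind3) residuals `hθ`/`hfinθ` and `ThetaFinite`; and (5) THE GAP input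
`Cor312Vol.GlobalVolumeTransport` (G-c312-11-1-SUPPLEMENT, kurims p. 184 l. 30–34, NOT asserted).
`hul_nonempty` is PROVED (`hul_nonempty_settingDHVol`); `hV`/`hG` are theorems (p415747).
[claim: Mochizuki2012, status: disputed] -/
theorem teamB_statement_of_globalVolumeTransport_settingDHVol
    (Ψm : ℤ → ∀ (j : (thetaIndex X).Label) (vQ : (thetaIndex X).VQ),
      (∀ e, (summandPiecesDH X hlog).X j vQ e) → ∀ e, (summandPiecesDH X hlog).X j vQ e)
    (hΨ : ∀ (m : ℤ) (j : (thetaIndex X).Label) (vQ : (thetaIndex X).VQ),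
      (summandPiecesDH X hlog).PreservesRegions j vQ (Ψm m j vQ))
    (hthetaEq0 : ∀ (m : ℤ) (i : Fin (thetaIndex X).lstar) (vQ : (thetaIndex X).VQ),
      (summandPiecesDH X hlog).e (Setting.labelSucc i) vQ ''
          (settingDHVol X hlog M archPk archSub Ψ act Mmod region n lat sig split qData thetaBox
            qCentre hq hfin).thetaRegion m (Setting.labelSucc i) vQ =
        Ψm m (Setting.labelSucc i) vQ '' ((summandPiecesDH X hlog).e (Setting.labelSucc i) vQ ''
          (settingDHVol X hlog M archPk archSub Ψ act Mmod region n lat sig split qData thetaBox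
            qCentre hq hfin).thetaRegion 0 (Setting.labelSucc i) vQ))
    (hbox0 : ∀ (i : Fin (thetaIndex X).lstar) (vQ : (thetaIndex X).VQ),
      IsHullSet (factorFieldDH X hlog (Setting.labelSucc i) vQ)
        (thetaBox 0 (settingDHVol X hlog M archPk archSub Ψ act Mmod region n lat sig split qData
          thetaBox qCentre hq hfin).thetaPilot (Setting.labelSucc i) vQ))
    (hθ : ∀ (i : Fin (thetaIndex X).lstar) (vQ : (thetaIndex X).VQ),
      ((situationDHVol X hlog M archPk archSub Ψ act Mmod region).D n).Adm _ vQ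
        ((settingDHVol X hlog M archPk archSub Ψ act Mmod region n lat sig split qData thetaBox
          qCentre hq hfin).thetaRegion3 (Setting.labelSucc i) vQ))
    (hfinθ : ∀ i : Fin (thetaIndex X).lstar, (Function.support fun vQ : (thetaIndex X).VQ =>
      ((situationDHVol X hlog M archPk archSub Ψ act Mmod region).D n).logvol _ vQ
        ((settingDHVol X hlog M archPk archSub Ψ act Mmod region n lat sig split qData thetaBox
          qCentre hq hfin).thetaRegion3 (Setting.labelSucc i) vQ)).Finite)
    (finite : (settingDHVol X hlog M archPk archSub Ψ act Mmod region n lat sig split qData thetaBox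
      qCentre hq hfin).ThetaFinite)
    (hgvt : GlobalVolumeTransport (settingDHVol X hlog M archPk archSub Ψ act Mmod region n lat sig
      split qData thetaBox qCentre hq hfin)) :
    (settingDHVol X hlog M archPk archSub Ψ act Mmod region n lat sig split qData thetaBox qCentre
      hq hfin).Statement :=
  teamB_statement_of_globalVolumeTransport_DH X hlog M archPk archSub Ψ act Mmod region
    (settingDHVol X hlog M archPk archSub Ψ act Mmod region n lat sig split qData thetaBox qCentre
      hq hfin)
    Ψm
    (fun j vQ => (settingDHVol X hlog M archPk archSub Ψ act Mmod region n lat sig split qData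
      thetaBox qCentre hq hfin).thetaRegion 0 j vQ)
    hΨ hthetaEq0
    (fun i vQ => adm_thetaRegion_settingDHVol X hlog M archPk archSub Ψ act Mmod region n lat sig
      split qData thetaBox qCentre hq hfin (hbox0 i vQ))
    hθ hfinθ
    (hul_nonempty_settingDHVol X hlog M archPk archSub Ψ act Mmod region n lat sig split qData
      thetaBox qCentre hq hfin)
    finite hgvt

end Real

end Thm311

end IUTFork

end Summit.ABC

end
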